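import Summits.QuantumFields.BalabanUV.T4Continuum.Support.ShellMeasureLandauEndRayStokes
import Summits.QuantumFields.BalabanUV.T4Continuum.Support.ShellMeasureLandauWilsonSquares

/-!
# `T4Continuum.ShellMeasureLandauEndFinal` — row S76 f2 «END-II-final, TWO 𝓔-SLOTS, (SM) DISCHARGED»: the live-level END
# `…print_rayE_stokes_live` with the Wilson ∕ non-Wilson ray pairs as separate slots (S74 `hE_add`) and SM-L2 (SM) discharged
# η-free by S73 `hSM_of_stokes` at `θ := εθ·η²`
(cell `pub-balaban`, sub-cell `t4`, spine estimate NE7c (node U5b); NE7c ROUND-2 crew, unit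
`b2b-balaban-t4-ne7c-formalise-leaf-04` gen 6; owner table `t4/b2b-balaban-t4-ne7c-p1/LEAVES-NE7c-P1.md` row **S76** (holder;
S76 f1 `ShellMeasureLandauEndRayStokes` p226578; OFFER «f2» journal l.17401, leaf-05-g7 GO l.17462 INFO-1); ADDITIVE — imports
S76 f1 and S74 f1 `ShellMeasureLandauWilsonSquares` (`hE_add`, `hB𝓔_add`) ONLY; [folklore]; 0 `def`, 0 `def … : Prop`,
0 sorry, 0 citation tags)

HONEST FRAMING.  Finite four-torus programme, rung (B)+1 only — NOT infinite volume, NOT a mass gap, NOT the Clay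
problem, NOT summit progress; (B), `BetaPertHyp`, (B^μ) not consumed.  NE7c (`T4IndicatorShell.ShellWeightBound`) is
NOT PRINTED and NOT PROVED; «NE7c ⇐ the named binders» (+ F-ne7cp1-g30-1 decay halves, + F-ne7cp1-g31-1 curl read-out);
(M1) realized ≠ NE7c (c3).  Nothing printed is asserted: B11 (19)∕(25)∕(37), B14 (2.17) and the scheme equation numbers
LOCATE the displayed SHAPES of binders, they are not citations.  HONEST DEPENDENCY (cell): continuum YM on T⁴ ⇐ BetaPertH
∧ nine spine estimates (0/9 proved); BetaPertH ⇐ (D1) ∧ (D4) ∧ CAP+tail; G-an2-4 gates asym, D1 and NE2/3/4.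

THE POINT.  After S76 f1 the live-level END had three binders that are NOT located inputs: the (SM) inequality `hSM`, and
the single 𝓔-ray pair `hE`∕`hB𝓔` (+ `h𝓔lb`).  Here (SM) is DISCHARGED from DISPLAYED η-scalings (S73 §5) and the 𝓔-slot is
SPLIT into the Wilson and the non-Wilson pair so that S74 (Wilson squares, near∕far plaquettes) and S71 f2 ∕ S78
(non-Wilson terms) plug in INDEPENDENTLY by name — whichever non-Wilson supplier the owner settles on (S78, journal l.17367).
WHAT REMAINS DISPLAYED after this file (c3): the two 𝓔-ray pairs' suppliers' located inputs (curl∕skew read-outs, `d_p`,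
square budget; located oscillations, pin), the classifier's read-out data with their η-scalings, the scheme data of the
LOCALIZED tuple, [dict].  NOTHING in the countdown moves; no estimate of Bałaban's is discharged.
-/

noncomputable section

open Set Metric NormedSpace MeasureTheory Function

namespace Summit.QuantumFields.BalabanUV.T4Continuum.ShellMeasureLandauEndFinal

open scoped ENNReal
open Literature.MathematicalPhysics.QuantumFieldTheory.Balaban1983to89
open B11Prop6Scheme (Prop4Hyp)
open GaugeField (GaugeInvariant)
open T4ShellMeasure (SlotAntiConcentration)
open T4CubePoincare (cube)
open T4CubeChartGnomonic (SU2)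
open T4CubeChartExp (expFibreChart)
open T4TreeGaugeFixing (NoClosedLoop fixTo)
open T4ShellMeasurePlaquette (expTail₂)
open ShellMeasureLevelAssembly (classifier)
open ShellMeasureLandauHolonomy (solAt landauExp)
open ShellMeasureLandauHolonomyChart (holOf cplx)
open ShellMeasureLandauHolonomySkew (readOutReal)
open ShellMeasureLandauHolonomyStokes (hSM_of_stokes)
open ShellMeasureLandauWilsonSquares (hE_add hB𝓔_add)
open ShellMeasureLandauEndRayStokes (slotAC_realized_su2_landauChart_print_rayE_stokes_live)

section Final

open scoped Matrix.Norms.L2Operator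

variable {P : Params} {j : ℕ} [DecidableEq (PBond P j)]
variable {n : Type*} [Fintype n] [DecidableEq n] [Nonempty n]
variable {𝒴 𝒴' 𝒳 𝒵 ℬ : Type*} [NormedAddCommGroup 𝒴] [NormedSpace ℂ 𝒴] [CompleteSpace 𝒴]
  [NormedAddCommGroup 𝒴'] [NormedSpace ℂ 𝒴'] [NormedAddCommGroup 𝒳] [NormedSpace ℂ 𝒳] [CompleteSpace 𝒳]
  [NormedAddCommGroup 𝒵] [NormedSpace ℂ 𝒵] [NormedAddCommGroup ℬ] [NormedSpace ℂ ℬ]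

/-- **END-II-FINAL WITH TWO 𝓔-SLOTS AND (SM) DISCHARGED** (RULINGS R-ne7cp1-g31-1∕-2, row S76 f2).  §3 of
`ShellMeasureLandauEndRayStokes` (`…print_rayE_stokes_live`: `P_w := ∅`, sections = co-test × `e^{−𝓔}`) with
(i) `𝓔 := 𝓔_W + 𝓔_E` — the WILSON part (`hEW`∕`hBW`, supplier S74 `hE_landau_wilsonSquares(_pinned)`; `𝓔_W ≥ 0` on the
S-ball, `hWlb` — the Wilson density `β(1 − Re tr(B_p W_p)∕N)` is nonnegative) PLUS the NON-WILSON part (`hEE`∕`hBE`,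
supplier S71 f2 `hE_landau_chartRay_pinned` or the owner's S78; lower bound `hElb`), joined by S74 `hE_add`;
(ii) SM-L2 (SM) NO LONGER A BINDER: discharged by S73 `hSM_of_stokes` from four DISPLAYED scalar inequalities (the
η-scalings `κ_c z̄ ≤ c₁η²z`, `κ_r z̄ ≤ c₂ηz`, `m κ_r z̄ ≤ 1` and the UNIT-currency smallness
`36(c₁z + m²c₂²z²)∕(r_Φ∕S − 1)² ≤ δ·εθ`) at the classifier threshold `θ := εθ·η²` — the `η²` CANCELS (F-ne7cp1-g31-1 (i)).
CONCLUSION: (M1) per slot, `SlotAntiConcentration ((fieldMeasure P j SU2).withDensity F) u (εθ·η²) ρ (2(m₀ + (B_W + B_E))∕(1−δ))`.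
Every remaining hypothesis is a scheme∕read-out∕locality∕real-structure datum of the LOCALIZED (classifier) tuple, a number,
or one of the two 𝓔-ray pairs; CONDITIONAL on all of them; nothing PRINTED is asserted (equation numbers LOCATE shapes);
NOT Bałaban's minimiser; (M1) realized ≠ NE7c. [folklore] -/
theorem slotAC_realized_su2_landauChart_final {T : Finset (PBond P j)} (hT : NoClosedLoop T)
    (U₀ : GaugeField P j SU2) (Λ : Finset (PBond P j)) {m₀ : ℕ} (e : ↥Λ × Fin 3 ≃ Fin m₀)
    {S : ℝ} (hS : 0 < S) (hSπ : 3 * S ^ 2 < Real.pi ^ 2) (c : GaugeField P j SU2 → GaugeField P j SU2)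
    {F : GaugeField P j SU2 → ℝ≥0∞} (hF : Measurable F) (hFi : GaugeInvariant F)
    (hFsupp : ∀ V y, F (fixTo T U₀ (updateFinset V Λ y)) ≠ 0 →
      ∀ b (hb : b ∈ Λ), dist1 ((c V b)⁻¹ * y ⟨b, hb⟩) ≤ 2 * Real.sin (S / 2))
    {u : GaugeField P j SU2 → ℝ} (hu : Measurable u) (hui : GaugeInvariant u)
    {ι : Type*} {Pu : Finset ι} (hPu : Pu.Nonempty)
    (W : GaugeField P j SU2 → Set (Fin m₀ → ℝ)) (Jco : GaugeField P j SU2 → (Fin m₀ → ℝ) → ℝ≥0∞)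
    {δ ρ β : ℝ}
    (𝒢 : GaugeField P j SU2 → (𝒵 →L[ℂ] 𝒴)) (W𝒱 : GaugeField P j SU2 → 𝒴 → 𝒵) {B₀ C₄ a₃ ε₄ : ℝ}
    (h𝒢 : ∀ V f, ‖𝒢 V f‖ ≤ B₀ * ‖f‖) (hW : ∀ V, Prop4Hyp (W𝒱 V) C₄ a₃) (hB₀ : 0 < B₀) (hC₄ : 0 ≤ C₄)
    (hε₄ : 0 ≤ ε₄)
    {dL C₁ B₃ ε₁ : ℝ} (hdL : 0 ≤ dL) (hC₁ : 0 ≤ C₁) (hε₁ : 0 ≤ ε₁) (hB₃ : dL ≤ B₃)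
    (h1 : 2 * B₀ * C₁ * B₃ * ε₁ ≤ ε₄) (h2 : 4 * ε₄ ≤ a₃) (h3 : 16 * B₀ * C₄ * ε₄ ≤ 1)
    (H₁ : GaugeField P j SU2 → (ℬ →L[ℂ] 𝒴)) (hH₁ : ∀ V B, ‖H₁ V B‖ ≤ B₀ * ‖B‖)
    (Φ : GaugeField P j SU2 → (Fin m₀ → ℂ) → ℬ) {rΦ : ℝ} (hΦd : ∀ V, DifferentiableOn ℂ (Φ V) (ball 0 rΦ))
    (hΦ0 : ∀ V, Φ V 0 = 0) (hΦ : ∀ V, ∀ z ∈ ball (0 : Fin m₀ → ℂ) rΦ, ‖Φ V z‖ < 2 * dL * C₁ * ε₁) (hSr : S < rΦ)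
    (Cf : GaugeField P j SU2 → 𝒴' → 𝒳) {C₂ RC : ℝ} (hC₂ : 0 ≤ C₂)
    (hCq : ∀ V, ∀ Z : 𝒴', ‖Z‖ < RC → ‖Cf V Z‖ ≤ C₂ * ‖Z‖ ^ 2) (hCd : ∀ V, DifferentiableOn ℂ (Cf V) (ball 0 RC))
    (ιs : GaugeField P j SU2 → (𝒴 →L[ℂ] 𝒴')) (hι : ∀ V Y, ‖ιs V Y‖ ≤ ‖Y‖)
    (Hop : GaugeField P j SU2 → (𝒳 →L[ℂ] 𝒴)) (hH : ∀ V X, ‖Hop V X‖ ≤ B₀ * ‖X‖)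
    {ε₃ : ℝ} (h18 : 18 * C₂ * B₀ * ε₃ ≤ 1) (hcoup : ε₄ + B₀ * (2 * dL * C₁ * ε₁) ≤ ε₃) (h3R : 3 * ε₃ ≤ RC)
    (ℓs : ι → List (𝒴 →L[ℂ] Matrix n n ℂ)) {κr : ℝ} (hκ : 0 ≤ κr)
    (hℓ : ∀ p ∈ Pu, ∀ ℓ ∈ ℓs p, ∀ Y, ‖ℓ Y‖ ≤ κr * ‖Y‖) {m : ℕ} (hlen : ∀ p ∈ Pu, (ℓs p).length ≤ m)
    {κc : ℝ} (hκc : 0 ≤ κc) (hcurl : ∀ p ∈ Pu, ∀ Y, ‖((ℓs p).map fun ℓ => ℓ Y).sum‖ ≤ κc * ‖Y‖)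
    -- THE TWO 𝓔-SLOTS (R-ne7cp1-g31-1): the WILSON part `𝓔W` (S74 `hE_landau_wilsonSquares(_pinned)` fills `hEW`; the Wilson
    -- density is nonnegative: `hWlb`) and the NON-WILSON part `𝓔E` (S71 f2 ∕ S78 fills `hEE`; a displayed lower bound `hElb`)
    (𝓔W 𝓔E : GaugeField P j SU2 → (Fin m₀ → ℝ) → ℝ) {BW BE BElb : ℝ}
    (hEW : ∀ V, ∀ x ∈ W V, ∀ c' : ℝ, 1 / 2 ≤ c' → c' ≤ 1 → 𝓔W V (c' • x) ≤ 𝓔W V x + (1 - c') * BW) (hBW : 0 ≤ BW)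
    (hEE : ∀ V, ∀ x ∈ W V, ∀ c' : ℝ, 1 / 2 ≤ c' → c' ≤ 1 → 𝓔E V (c' • x) ≤ 𝓔E V x + (1 - c') * BE) (hBE : 0 ≤ BE)
    (hWlb : ∀ V (y : Fin m₀ → ℝ), ‖y‖ ≤ S → 0 ≤ 𝓔W V y)
    (hElb : ∀ V (y : Fin m₀ → ℝ), ‖y‖ ≤ S → -BElb ≤ 𝓔E V y)
    (L : Set (𝒴 →L[ℂ] Matrix n n ℂ))
    (𝓡𝒵 : AddSubgroup 𝒵) (𝓡𝒴' : AddSubgroup 𝒴') (𝓡𝒳 : AddSubgroup 𝒳) (h𝓡𝒳 : IsClosed (𝓡𝒳 : Set 𝒳))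
    (𝓡ℬ : AddSubgroup ℬ)
    (h𝒢r : ∀ V, ∀ f ∈ 𝓡𝒵, 𝒢 V f ∈ readOutReal L) (hWr : ∀ V, ∀ Y ∈ readOutReal L, W𝒱 V Y ∈ 𝓡𝒵)
    (hιr : ∀ V, ∀ Y ∈ readOutReal L, ιs V Y ∈ 𝓡𝒴') (hHr : ∀ V, ∀ X ∈ 𝓡𝒳, Hop V X ∈ readOutReal L)
    (hCr : ∀ V, ∀ Z ∈ 𝓡𝒴', Cf V Z ∈ 𝓡𝒳) (hH₁r : ∀ V, ∀ B ∈ 𝓡ℬ, H₁ V B ∈ readOutReal L)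
    (hΦr : ∀ V, ∀ y : Fin m₀ → ℝ, ‖y‖ ≤ S → Φ V (cplx y) ∈ 𝓡ℬ)
    (hRdict : ∀ V, ∀ x ∈ cube m₀ S,
      F (fixTo T U₀ (updateFinset V Λ (expFibreChart Λ (c V) e x))) =
        Jco V x * ENNReal.ofReal (Real.exp (-(𝓔W V x + 𝓔E V x))))
    (hudict : ∀ V, ∀ x ∈ cube m₀ S,
      u (fixTo T U₀ (updateFinset V Λ (expFibreChart Λ (c V) e x))) =
        classifier hPu (fun p => holOf (ℓs p) (fun y => landauExp (Cf V) (ιs V) (Hop V)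
          (4 * C₂ * (ε₄ + B₀ * (2 * dL * C₁ * ε₁)) ^ 2)
          (solAt (𝒢 V) 0 (W𝒱 V) ε₄ (0 : 𝒵) (H₁ V (Φ V (cplx y))) + H₁ V (Φ V (cplx y))))) x)
    (hJW : ∀ V x, Jco V x ≠ 0 → x ∈ W V)
    (hJ : ∀ V x, ∀ a : ℝ, 0 ≤ a → Jco V x ≤ Jco V (Real.exp (-a) • x))
    (hJ1 : ∀ V x, Jco V x ≤ 1)
    (hWS : ∀ V, W V ⊆ closedBall (0 : Fin m₀ → ℝ) S)
    (hδ0 : 0 ≤ δ) (hδ1 : δ < 1) (hρ0 : 0 ≤ ρ) (hρ : ρ ≤ (1 - δ) / 2) (hβ : 0 ≤ β)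
    -- SM-L2 (SM) DISCHARGED IN THE STOKES CURRENCY (S73 `hSM_of_stokes`): the η-scalings of the classifier's read-out data
    -- DISPLAYED — curl read-out × field size `κ_c·z̄ ≤ c₁η²z` (B11 (25)∕(37) TYPE), letter size `κ_r·z̄ ≤ c₂ηz` ((19) TYPE),
    -- regime `m·κ_r·z̄ ≤ 1` — the UNIT-currency smallness `36(c₁z + m²c₂²z²)∕(r_Φ∕S − 1)² ≤ δ·εθ`, and the classifier
    -- threshold `θ := εθ·η²` (B14 (2.17) TYPE): the `η²` CANCELS
    {η εθ c₁ c₂ z : ℝ} (hη : 0 < η) (hεθ : 0 < εθ)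
    (hs₁ : κc * ((ε₄ + B₀ * (2 * dL * C₁ * ε₁)) + B₀ * (4 * C₂ * (ε₄ + B₀ * (2 * dL * C₁ * ε₁)) ^ 2)) ≤ c₁ * η ^ 2 * z)
    (ha : κr * ((ε₄ + B₀ * (2 * dL * C₁ * ε₁)) + B₀ * (4 * C₂ * (ε₄ + B₀ * (2 * dL * C₁ * ε₁)) ^ 2)) ≤ c₂ * η * z)
    (hma : m * (κr * ((ε₄ + B₀ * (2 * dL * C₁ * ε₁)) + B₀ * (4 * C₂ * (ε₄ + B₀ * (2 * dL * C₁ * ε₁)) ^ 2))) ≤ 1)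
    (hsm : 36 * (c₁ * z + m ^ 2 * c₂ ^ 2 * z ^ 2) / (rΦ / S - 1) ^ 2 ≤ δ * εθ) :
    SlotAntiConcentration ((fieldMeasure P j SU2).withDensity F) u (εθ * η ^ 2) ρ
      (2 * ((m₀ : ℝ) + (BW + BE)) / (1 - δ)) := by
  have hRad1 : 1 < rΦ / S := by rw [lt_div_iff₀ hS]; linarith
  have hκz : 0 ≤ κr * ((ε₄ + B₀ * (2 * dL * C₁ * ε₁)) + B₀ * (4 * C₂ * (ε₄ + B₀ * (2 * dL * C₁ * ε₁)) ^ 2)) := by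
    positivity
  -- (SM) in the Stokes currency, η-free (S73): `hSM` at `(H, θ) = (κ_c z̄ + expTail₂(m κ_r z̄), εθ·η²)`
  have hSM := hSM_of_stokes (δ := δ) hRad1 hη hκz hs₁ ha hma hsm
  -- the two 𝓔-slots add (S74 `hE_add`); the lower bound of the sum
  exact slotAC_realized_su2_landauChart_print_rayE_stokes_live hT U₀ Λ e hS hSπ c hF hFi hFsupp hu hui hPu W Jco 𝒢 W𝒱
    h𝒢 hW hB₀ hC₄ hε₄ hdL hC₁ hε₁ hB₃ h1 h2 h3 H₁ hH₁ Φ hΦd hΦ0 hΦ hSr Cf hC₂ hCq hCd ιs hι Hop hH h18 hcoup h3R ℓs hκ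
    hℓ hlen hκc hcurl (fun V y => 𝓔W V y + 𝓔E V y) (B𝓔lb := BElb)
    (fun V => hE_add (hEW V) (hEE V)) (hB𝓔_add hBW hBE)
    (fun V y hy => by have h1 := hWlb V y hy; have h2 := hElb V y hy; linarith)
    L 𝓡𝒵 𝓡𝒴' 𝓡𝒳 h𝓡𝒳 𝓡ℬ h𝒢r hWr hιr hHr hCr hH₁r hΦr hRdict hudict hJW hJ hJ1 hWS (by positivity) hδ0 hδ1 hρ0 hρ hβ hSM

end Final

end Summit.QuantumFields.BalabanUV.T4Continuum.ShellMeasureLandauEndFinal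

end
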